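import Summits.Langlands.Langlands.Theses.RamifiedCoefficientSeed
import HarnessLib

/-!
# Birth skeleton (BC3) for the split child `CompatibilityAwayFromLAll` of `RamifiedCoefficientSeed.SectorComplement`
(crux-strategist cstrat-stmt-Langlands-16781-r1, 2026-08-17; child item: NEW child of stmt-Langlands-16781)

L∤∀ = Taylor 2004 Conj. 7 at every `v ∤ ℓ`, for EVERY reciprocity datum.  REGIME SPLIT by the place: the GOOD places (π and
ρ unramified at `v` and Satake–Frobenius compatible AT `v`: the unramified dictionary `rec_v(Ind χ) = ⊕ χ_i ∘ Art_v⁻¹` versus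
`WD(ρ|_v) = (ρ(Frob_v)^{ss}, N = 0)` — in print formal (Buzzard–Gee Rem. 3.2.5), in tree the "landed wave"
`stub_rankN_localGlobalCompatibleAt_of_satakeFrobCompatibleAt`-type lemmas of crux 14328; size M–L) and the BAD places (the
finitely many where `π` or `ρ` ramifies or the pointwise Satake clause fails: Carayol, Harris–Taylor, Taylor–Yoshida, Caraiani,
Varma up to `N` for regular conjugate-self-dual `π` over CM; OPEN in general — size open-problem).

PRE-SPLIT COPY: the child is a local `def` with the child's text verbatim (the route decl
`Summit.Langlands.Langlands.Theses.RamifiedCoefficientSeed.CompatibilityAwayFromLAll` exists only after `route edit --split`); the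
post-split version replaces the `def` by `open Summit.Langlands.Langlands.Theses.RamifiedCoefficientSeed (CompatibilityAwayFromLAll)` and is
otherwise identical (folder `post/`).  `lean check`: rc 0, sorries = the `stub_*` only; `CompatibilityAwayFromLAll_of` concludes the child BY NAME.
-/

noncomputable section

set_option linter.dupNamespace false

namespace Summit.Langlands.Langlands.Cruxes.SectorComplement.BirthCompatibilityAwayFromLAll

open scoped NumberField Classical Topology
open Filter IsDedekindDomain
open Literature.NumberTheory.Automorphic Literature.NumberTheory.GaloisRepresentations
open Summit.Langlands

/-- The child, verbatim (pre-split local copy). -/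
def CompatibilityAwayFromLAll : Prop :=
  ∀ (K : Type) [Field K] [NumberField K] (Rec : ReciprocityData K) (n : ℕ) (hcpt : Literature.NumberTheory.Automorphic.isCompact_glFiniteIntegralLevel n K), 0 < n → ∀ (π : Literature.NumberTheory.Automorphic.CuspidalAutomorphicRepData n K hcpt), π.1.IsLAlgebraic → ∀ (ℓ : ℕ) [Fact ℓ.Prime] (ι : PadicAlgCl ℓ ≃+* ℂ) (ρ : Literature.NumberTheory.GaloisRepresentations.FramedGaloisRep K (PadicAlgCl ℓ) n), ρ.toGaloisRep.IsIrreducible → ((∀ᶠ v : IsDedekindDomain.HeightOneSpectrum (NumberField.RingOfIntegers K) in cofinite, ρ.IsUnramifiedAt v) ∧ ∀ (v : IsDedekindDomain.HeightOneSpectrum (NumberField.RingOfIntegers K)) (hv : ((ℓ : ℕ) : NumberField.RingOfIntegers K) ∈ v.asIdeal), (Literature.NumberTheory.PAdicHodge.fontainePstAdicCompletion v ℓ hv).IsDeRhamFramed (ρ.toLocal v)) → (∀ᶠ v : IsDedekindDomain.HeightOneSpectrum (NumberField.RingOfIntegers K) in cofinite, SatakeFrobCompatibleAt ι π.1 ρ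 v) → ∀ v : IsDedekindDomain.HeightOneSpectrum (NumberField.RingOfIntegers K), ((ℓ : ℕ) : NumberField.RingOfIntegers K) ∉ v.asIdeal → LocalGlobalCompatibleAt Rec ι π.1 ρ v

/-- **stub GOOD PLACES** — for every datum `Rec`, local–global compatibility at a place `v ∤ ℓ` where the pair is
Satake–Frobenius compatible AT `v` (both sides unramified; the unramified dictionary).  In print: formal from the
normalisation of `rec_v` on unramified principal series (Harris–Taylor Thm. A (iv)–(v) / BG Rem. 3.2.5); in tree: the
rank-`n` unramified local–global lemmas of crux stmt-Langlands-14328 for ONE datum, to be re-run for every Henniart-normalised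
datum.  Why plausibly true: it is the unramified case of Taylor's Conj. 7.  Size M–L.
[cite: BuzzardGeeLMS2014, Rem. 3.2.5] [cite: HarrisTaylorAMS2001, Thm. A] -/
theorem stub_goodPlaces : ∀ (K : Type) [Field K] [NumberField K] (Rec : ReciprocityData K) (n : ℕ) (hcpt : Literature.NumberTheory.Automorphic.isCompact_glFiniteIntegralLevel n K), 0 < n → ∀ (π : Literature.NumberTheory.Automorphic.CuspidalAutomorphicRepData n K hcpt), π.1.IsLAlgebraic → ∀ (ℓ : ℕ) [Fact ℓ.Prime] (ι : PadicAlgCl ℓ ≃+* ℂ) (ρ : Literature.NumberTheory.GaloisRepresentations.FramedGaloisRep K (PadicAlgCl ℓ) n), ρ.toGaloisRep.IsIrreducible → ((∀ᶠ v : IsDedekindDomain.HeightOneSpectrum (NumberField.RingOfIntegers K) in cofinite, ρ.IsUnramifiedAt v) ∧ ∀ (v : IsDedekindDomain.HeightOneSpectrum (NumberField.RingOfIntegers K)) (hv : ((ℓ : ℕ) : NumberField.RingOfIntegers K) ∈ v.asIdeal), (Literature.NumberTheory.PAdicHodge.fontainePstAdicCompletion v ℓ hv).IsDeRhamFramed (ρ.toLocal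 v)) → (∀ᶠ v : IsDedekindDomain.HeightOneSpectrum (NumberField.RingOfIntegers K) in cofinite, SatakeFrobCompatibleAt ι π.1 ρ v) → ∀ v : IsDedekindDomain.HeightOneSpectrum (NumberField.RingOfIntegers K), ((ℓ : ℕ) : NumberField.RingOfIntegers K) ∉ v.asIdeal → SatakeFrobCompatibleAt ι π.1 ρ v → LocalGlobalCompatibleAt Rec ι π.1 ρ v := by
  sorry

/-- **stub BAD PLACES** — for every datum `Rec`, local–global compatibility at the (finitely many) places `v ∤ ℓ` where the
pointwise Satake clause fails (ramified `π_v` or `ρ|_v`, or an unramified mismatch — excluded in print by strong multiplicity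
one + Chebotarev).  Known for regular conjugate-self-dual `π` over CM fields (Harris–Taylor, Taylor–Yoshida, Caraiani; Varma
2024 up to the monodromy operator in the non-polarisable regular case); OPEN for irregular `π`, general `F`, and `N` in general.
Why it might fail: a corresponding pair with a local mismatch at a ramified place (none known).  Size open-problem.
[cite: TaylorGaloisRepresentations2004, Conj. 7] [cite: VarmaFMS2024, Thm. 1] [cite: Caraiani2012, Thm. 1.1] -/
theorem stub_badPlaces : ∀ (K : Type) [Field K] [NumberField K] (Rec : ReciprocityData K) (n : ℕ) (hcpt : Literature.NumberTheory.Automorphic.isCompact_glFiniteIntegralLevel n K), 0 < n → ∀ (π : Literature.NumberTheory.Automorphic.CuspidalAutomorphicRepData n K hcpt), π.1.IsLAlgebraic → ∀ (ℓ : ℕ) [Fact ℓ.Prime] (ι : PadicAlgCl ℓ ≃+* ℂ) (ρ : Literature.NumberTheory.GaloisRepresentations.FramedGaloisRep K (PadicAlgCl ℓ) n), ρ.toGaloisRep.IsIrreducible → ((∀ᶠ v : IsDedekindDomain.HeightOneSpectrum (NumberField.RingOfIntegers K) in cofinite, ρ.IsUnramifiedAt v) ∧ ∀ (v : IsDedekindDomain.HeightOneSpectrum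 (NumberField.RingOfIntegers K)) (hv : ((ℓ : ℕ) : NumberField.RingOfIntegers K) ∈ v.asIdeal), (Literature.NumberTheory.PAdicHodge.fontainePstAdicCompletion v ℓ hv).IsDeRhamFramed (ρ.toLocal v)) → (∀ᶠ v : IsDedekindDomain.HeightOneSpectrum (NumberField.RingOfIntegers K) in cofinite, SatakeFrobCompatibleAt ι π.1 ρ v) → ∀ v : IsDedekindDomain.HeightOneSpectrum (NumberField.RingOfIntegers K), ((ℓ : ℕ) : NumberField.RingOfIntegers K) ∉ v.asIdeal → ¬ SatakeFrobCompatibleAt ι π.1 ρ v → LocalGlobalCompatibleAt Rec ι π.1 ρ v := by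
  sorry

namespace _Goal

/-- The statement of `stub_goodPlaces` (literally its type). [folklore] -/
def stub_goodPlaces : Prop :=
  type_of% @Summit.Langlands.Langlands.Cruxes.SectorComplement.BirthCompatibilityAwayFromLAll.stub_goodPlaces

/-- The statement of `stub_badPlaces` (literally its type). [folklore] -/
def stub_badPlaces : Prop :=
  type_of% @Summit.Langlands.Langlands.Cruxes.SectorComplement.BirthCompatibilityAwayFromLAll.stub_badPlaces

end _Goal

/-- **L∤∀ from its two stubs**: excluded middle on the pointwise Satake clause at the place `v`. -/
theorem CompatibilityAwayFromLAll_of (hg : _Goal.stub_goodPlaces) (hb : _Goal.stub_badPlaces) : CompatibilityAwayFromLAll := by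
  dsimp only [_Goal.stub_goodPlaces, _Goal.stub_badPlaces] at hg hb
  intro K _ _ Rec n hcpt hn π hL ℓ _ ι ρ hirr hgeo hρ v hv
  by_cases h : SatakeFrobCompatibleAt ι π.1 ρ v
  · exact hg K Rec n hcpt hn π hL ℓ ι ρ hirr hgeo hρ v hv h
  · exact hb K Rec n hcpt hn π hL ℓ ι ρ hirr hgeo hρ v hv h

/-- by-name sanity check -/
example : CompatibilityAwayFromLAll := CompatibilityAwayFromLAll_of stub_goodPlaces stub_badPlaces

end Summit.Langlands.Langlands.Cruxes.SectorComplement.BirthCompatibilityAwayFromLAll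

end
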